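import Summits.ResolutionOfSingularities.ResolutionOfSingularities.Theorems.EquisingularLiftEquisingularLiftNatFirstOrderStrictTransform
import Summits.ResolutionOfSingularities.ResolutionOfSingularities.Theorems.EquisingularLiftEquisingularLiftNatOneStepPoints
import Summits.ResolutionOfSingularities.ResolutionOfSingularities.Theorems.EquisingularLiftEquisingularLiftNatMultiOrdinaryPointsJacobian
import Summits.ResolutionOfSingularities.ResolutionOfSingularities.Theorems.EquisingularLiftEquisingularLiftBlowupModelOrdinaryPoints
import HarnessLib

/-!
# Crux `EquisingularLift` (stmt-ResolutionOfSingularities-15660): the OPEN residual `stub_blowupModel_ge_five` holds for every hypersurface whose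
# singular points are ONE-STEP / FIRST-ORDER POINTS at coordinate vertices — every characteristic, every dimension

[OURS · leafhand-res-equisingularlift-9 g0, 2026-08-31; cell `pub/decomp-res`] AI-produced, weaker than expert review; NOT a statement of any manuscript;
nothing here proves resolution of singularities in positive characteristic.  DEF-FREE helper, `--supports stmt-…-15660`; standard axioms; ZERO named
hypotheses.

leafhand-7 g1's ✓ `StrataSplit.blowupModel_ordinaryPoints` (…BlowupModelOrdinaryPoints) records the DOWNSTAIRS content of T-MULTIORD in the currency of the
open residual of crux `EquisingularLift` («`∃ 𝔞 ≠ ⊥` on `H` all of whose blow-ups are regular» = «`H` has a projective resolution»,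
✓ `blowupModel_iff_projectiveResolution`) for ORDINARY multiple points.  This file does the same for seat res-D-pv-013's ONE-STEP points (T-ONESTEP,
✓ `OneStep.isRegularLocalRing_stalk_of_isBlowup_comap`: singular tangent cone allowed, explicit strict transforms `G_l` with a Jacobian certificate) and
for this hand's FIRST-ORDER points (✓ `FirstOrderPoint.exists_strictTransform`: the intrinsic criterion «`Φ_μ`, `∇Φ_μ`, `Ψ_{μ+1}` have no common
non-zero zero» supplies the `G_l`):

* `OneStep.isRegular_of_isBlowup_comap_prod` — over ANY field: `F` a prime form, `S` duplicate-free, every `c ∈ S` a one-step point at which the chart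
  `F(x_c := 1)` has its only singularity, the charts `c ∉ S` regular ⟹ **every blow-up of `H = V₊(F)` along `Π_{c∈S} Λ_c·𝒪_H` is regular** (verbatim
  ✓ `MultiOrd.isRegular_of_isBlowup_comap_prod` with the one-step pointwise lemma);
* ★ `StrataSplit.blowupModel_oneStepPoints` / ★ `StrataSplit.blowupModel_firstOrderPoints` — **hence `H` has a regular blow-up model** (the ideal sheaf is
  `≠ ⊥` by ✓ `MultiOrd.comap_prod_ne_bot`): ALL-CHARACTERISTIC, ALL-DIMENSION, ALL-FIELD families of instances of the conclusion of `stub_blowupModel_ge_five`,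
  containing the `A₂` points and the characteristic-2 nodes that ✓ `blowupModel_ordinaryPoints` misses;
* ★ `StrataSplit.blowupModel_of_range_eq_firstOrderPoints` — the same in the crux's binder shape `(H, ι)`, `range ι = V₊(F)` (✓ `blowupModel_of_range_eq`);
* ★ `StrataSplit.blowupModel_of_range_eq_firstOrderPoints_of_jacobian` — over `K = K̄`, with the hypotheses on CLOSED POINTS: (jac) the singular points of
  `V₊(F)` are among the marked vertices, (fo) `Φ(b) = ∇Φ(b) = Ψ₁(b) = 0` only for `b = 0`.

Honest label: no registered stub closed; `stub_blowupModel_ge_five` stays OPEN; these are instances of its conclusion.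

References: [Hartshorne1977, I Thm. 5.1, II Ex. 7.12]; [StacksProject, Tags 080A, 0804, 0BIQ]; [Matsumura1987, Thm. 14.2] — through the cited tree files.
-/

set_option linter.dupNamespace false -- mandated namespace `Summit.<Summit>.<Problem>` of this single-conjunct summit

noncomputable section

open CategoryTheory CategoryTheory.Limits AlgebraicGeometry TopologicalSpace
open MvPolynomial HomogeneousLocalization
open Literature.AlgebraicGeometry.Resolution
open Literature.AlgebraicGeometry.Motives Literature.AlgebraicGeometry.Motives.SmoothHypersurface
open Literature.AlgebraicGeometry.Motives.ProjectiveSpace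
open AlgebraicGeometry.Scheme.IdealSheafData
open Summit.ResolutionOfSingularities.ResolutionOfSingularities.Cruxes.EquisingularLift.StrataSplit

namespace Summit.ResolutionOfSingularities.ResolutionOfSingularities.Cruxes.EquisingularLiftNat.Sections

namespace OneStep

variable (K : Type) [Field K] {m : ℕ} (F : MvPolynomial (Fin (m + 2 + 1)) K) {d : ℕ} (hF : F.IsHomogeneous d) (hFp : Prime F)

include hFp in
/-- **DOWNSTAIRS, over any field: every blow-up of `H = V₊(F)` along the product `Π_{c∈S} Λ_c·𝒪_H` of marked vertex points is regular** when `F` is a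
prime form, each marked vertex `P_c` (`c ∈ S`, `S` duplicate-free) is a ONE-STEP point — `F(x_c := 1) = Φ + Ψ`, `Φ ≠ 0` a form of degree `μ ≥ 1`,
`Ψ ∈ (y)^{μ+1}`, with explicit strict transforms `G_l` (`(Φ+Ψ)(T_l, T_lT_j) = T_l^μ·G_l`) passing the Jacobian criterion at the primes containing `T_l` — at
which the chart `F(x_c := 1)` has its only singularity (prime-ideal Jacobian hypothesis), and the charts `c ∉ S` are regular rings.  Verbatim
✓ `MultiOrd.isRegular_of_isBlowup_comap_prod` with ✓ `OneStep.isRegularLocalRing_stalk_of_isBlowup_comap` at the marked vertices.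
[cite: StacksProject, Tag 080A] [cite: Hartshorne1977, I Thm. 5.1] [cite: Matsumura1987, Thm. 14.2] -/
theorem isRegular_of_isBlowup_comap_prod (S : List (Fin (m + 2 + 1))) (hS : S.Nodup)
    (hone : ∀ c ∈ S, ∃ (μ : ℕ) (Φ Ψ : MvPolynomial (Fin (m + 2)) K), 1 ≤ μ ∧ Φ.IsHomogeneous μ ∧ Φ ≠ 0 ∧
      Ψ ∈ Ideal.span (Set.range (X : Fin (m + 2) → MvPolynomial (Fin (m + 2)) K)) ^ (μ + 1) ∧ ProjectiveSpace.dehomogenize K c F = Φ + Ψ ∧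
      ∀ l : Fin (m + 2), ∃ G : MvPolynomial (Fin (m + 2)) K,
        aeval (fun j => X l * Function.update (X : Fin (m + 2) → MvPolynomial (Fin (m + 2)) K) l 1 j) (Φ + Ψ) = X l ^ μ * G ∧
        ∀ P : Ideal (MvPolynomial (Fin (m + 2)) K), P.IsPrime → (X l : MvPolynomial (Fin (m + 2)) K) ∈ P → G ∈ P → ∃ j, pderiv j G ∉ P)
    (hsing : ∀ c ∈ S, ∀ P : Ideal (MvPolynomial (Fin (m + 2)) K), P.IsPrime → ProjectiveSpace.dehomogenize K c F ∈ P →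
      (∀ j, pderiv j (ProjectiveSpace.dehomogenize K c F) ∈ P) → ∀ j, (X j : MvPolynomial (Fin (m + 2)) K) ∈ P) :
    letI := MvPolynomial.gradedAlgebra (σ := Fin (m + 2 + 1)) (R := K)
    letI := MvPolynomial.gradedAlgebra (σ := Fin (0 + 1)) (R := K)
    ∀ (_hoffS : ∀ c, c ∉ S → IsRegularRing (ChartRing F c hF))
      (fk : Fin (m + 2 + 1) → (homogeneousSubmodule (Fin (m + 2 + 1)) K →+*ᵍ homogeneousSubmodule (Fin (0 + 1)) K))
      (hfk' : ∀ c, HomogeneousIdeal.irrelevant (homogeneousSubmodule (Fin (0 + 1)) K) ≤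
        (HomogeneousIdeal.irrelevant (homogeneousSubmodule (Fin (m + 2 + 1)) K)).map (fk c))
      (_hfkC : ∀ c (a : K), fk c (C a) = C a) (_hfke : ∀ c (j : Fin 1), fk c (X c) = X j)
      (_hfk0 : ∀ c (i : Fin (m + 2 + 1)), i ≠ c → fk c (X i) = 0)
      (Z : Scheme.{0}) (ρ : Z ⟶ (hypersurface F).left),
      IsBlowup ρ (((S.map fun c => (Proj.map (fk c) (hfk' c)).ker).prod).comap (hypersurfaceι F).left) → Scheme.IsRegular Z := by
  letI := MvPolynomial.gradedAlgebra (σ := Fin (m + 2 + 1)) (R := K)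
  letI := MvPolynomial.gradedAlgebra (σ := Fin (0 + 1)) (R := K)
  intro hoffS fk hfk' hfkC hfke hfk0 Z ρ hρ
  classical
  have hd : 0 < d := ConeN.pos_of_prime_of_isHomogeneous K F hF hFp
  have he : ∀ c : Fin (m + 2 + 1), Function.Injective (fun _ : Fin 1 => c) := fun c => Function.injective_of_subsingleton _
  have hec : ∀ c : Fin (m + 2 + 1), ∀ j : Fin 1, (fun _ : Fin 1 => c) j = c := fun _ _ => rfl
  have hfkeR : ∀ c, ∀ j : Fin 1, fk c (X ((fun _ : Fin 1 => c) j)) = X j := fun c j => hfke c j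
  have hfk0R : ∀ c, ∀ i : Fin (m + 2 + 1), i ∉ Set.range (fun _ : Fin 1 => c) → fk c (X i) = 0 :=
    fun c i hi => hfk0 c i (fun h => hi ⟨0, h.symm⟩)
  -- radicality of the chart equations at the marked vertices
  have hrad : ∀ c ∈ S, (Ideal.span {ProjectiveSpace.dehomogenize K c F}).radical = Ideal.span {ProjectiveSpace.dehomogenize K c F} := by
    intro c hc
    obtain ⟨μ, Φ, Ψ, hμ, hΦ, -, hΨ, hdeh, -⟩ := hone c hc
    rw [hdeh]
    exact OrdPointAt.radical_span_dehomogenize_eq K F c hF hFp Φ Ψ hΦ hμ hΨ hdeh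
  rw [MultiCentre.comap_list_prod, List.map_map] at hρ
  refine MultiCentre.isRegular_of_prod _ ?_ ?_ ?_ hρ
  · -- pairwise disjoint supports
    rw [List.pairwise_map]
    refine hS.pairwise_of_forall_ne fun c _ c' _ hcc' => ?_
    simp only [Function.comp_apply]
    rw [Set.disjoint_iff]
    rintro x ⟨hx, hx'⟩
    have h1 : (hypersurfaceι F).left x ∈ ((Proj.map (fk c) (hfk' c)).ker.support : Set (Proj (homogeneousSubmodule (Fin (m + 2 + 1)) K))) := by
      have h := hx; rwa [Scheme.IdealSheafData.support_comap] at h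
    have h2 : (hypersurfaceι F).left x ∈ ((Proj.map (fk c') (hfk' c')).ker.support : Set (Proj (homogeneousSubmodule (Fin (m + 2 + 1)) K))) := by
      have h := hx'; rwa [Scheme.IdealSheafData.support_comap] at h
    exact (CoordPoints.disjoint_support_ker fk hfk' hfkC hfke hfk0 hcc').le_bot ⟨h1, h2⟩
  · -- each factor: a one-step point, resolved pointwise; off it the blow-up is a local isomorphism
    intro I hI X₁ τ₁ hτ₁ z hz
    obtain ⟨c, hc, rfl⟩ := List.mem_map.mp hI
    simp only [Function.comp_apply] at hτ₁ hz ⊢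
    by_cases hzs : τ₁ z ∈ ((((Proj.map (fk c) (hfk' c)).ker).comap (hypersurfaceι F).left).support : Set (hypersurface F).left)
    · obtain ⟨μ, Φ, Ψ, hμ, hΦ, hΦ0, hΨ, hdeh, hG⟩ := hone c hc
      exact OneStep.isRegularLocalRing_stalk_of_isBlowup_comap K F c hF hFp (hec c) (fk c) (hfk' c) (hfkC c) (hfkeR c) (hfk0R c)
        Φ Ψ hΦ hμ hΦ0 hΨ hdeh hG hτ₁ z hzs
    · rcases hz with hz | hz
      · exact absurd hz hzs
      · haveI := hτ₁.isIso_stalkMap_of_not_mem_support hzs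
        haveI : IsRegularLocalRing ((hypersurface F).left.presheaf.stalk (τ₁ z)) := hz
        exact IsRegularLocalRing.of_ringEquiv (R := (hypersurface F).left.presheaf.stalk (τ₁ z)) (asIso (τ₁.stalkMap z)).commRingCatIsoToRingEquiv
  · -- `H` is regular off the marked vertices
    intro x hx
    refine MultiOrd.isRegularLocalRing_stalk_of_forall_exists K F hF hd S (fun c hc => ⟨hrad c hc, hsing c hc⟩) hoffS x (fun c hc => ?_)
    have hxc : (hypersurfaceι F).left x ∉ ((Proj.map (fk c) (hfk' c)).ker.support : Set (Proj (homogeneousSubmodule (Fin (m + 2 + 1)) K))) := by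
      intro h
      apply hx
      rw [IdealSheafData.coe_support_prod, Set.mem_iUnion₂]
      refine ⟨_, List.mem_map.mpr ⟨c, hc, rfl⟩, ?_⟩
      simp only [Function.comp_apply]
      rw [Scheme.IdealSheafData.support_comap]
      exact h
    obtain ⟨a, ha, hXa⟩ := LinearCentre.exists_X_not_mem_of_not_mem_support (fun _ : Fin 1 => c) (he c) (fk c) (hfk' c) (hfkC c) (hfkeR c)
      (hfk0R c) hxc
    exact ⟨a, (OrdPointAt.not_mem_range_iff c (hec c) a).mp ha, (Proj.mem_basicOpen _ _ _).mpr hXa⟩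

end OneStep

end Summit.ResolutionOfSingularities.ResolutionOfSingularities.Cruxes.EquisingularLiftNat.Sections

namespace Summit.ResolutionOfSingularities.ResolutionOfSingularities.Cruxes.EquisingularLift.StrataSplit

open Summit.ResolutionOfSingularities.ResolutionOfSingularities.Cruxes.EquisingularLiftNat.Sections
open Summit.ResolutionOfSingularities.ResolutionOfSingularities.Cruxes.EquisingularLiftNat

/-- ★ **Hypersurfaces whose singular points are ONE-STEP POINTS at coordinate vertices have regular blow-up models — every field, every characteristic,
every dimension.**  `F ∈ K[x₀,…,x_{m+2}]` a prime form; `S` a duplicate-free list of coordinates; for `c ∈ S` the vertex chart `F(x_c := 1) = Φ + Ψ` with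
`Φ ≠ 0` a form of degree `μ ≥ 1`, `Ψ ∈ (y)^{μ+1}` and explicit strict transforms `G_l` passing the Jacobian criterion along the exceptional divisor, singular
at most at the origin (prime-ideal Jacobian hypothesis); the charts `c ∉ S` regular.  Then `H = V₊(F)` carries a non-zero ideal sheaf — the trace of the
product of the vertex points — ALL of whose blow-ups are regular (`OneStep.isRegular_of_isBlowup_comap_prod`, ✓ `MultiOrd.comap_prod_ne_bot`): the
conclusion of the open residual `stub_blowupModel_ge_five` at these `H` (e.g. the `3A₂` cubic surface, every characteristic).
[cite: Hartshorne1977, II Ex. 7.12] [cite: StacksProject, Tag 080A] -/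
theorem blowupModel_oneStepPoints (K : Type) [Field K] {m : ℕ} (F : MvPolynomial (Fin (m + 2 + 1)) K) {d : ℕ} (hF : F.IsHomogeneous d)
    (hFp : Prime F) (S : List (Fin (m + 2 + 1))) (hS : S.Nodup)
    (hone : ∀ c ∈ S, ∃ (μ : ℕ) (Φ Ψ : MvPolynomial (Fin (m + 2)) K), 1 ≤ μ ∧ Φ.IsHomogeneous μ ∧ Φ ≠ 0 ∧
      Ψ ∈ Ideal.span (Set.range (X : Fin (m + 2) → MvPolynomial (Fin (m + 2)) K)) ^ (μ + 1) ∧ ProjectiveSpace.dehomogenize K c F = Φ + Ψ ∧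
      ∀ l : Fin (m + 2), ∃ G : MvPolynomial (Fin (m + 2)) K,
        aeval (fun j => X l * Function.update (X : Fin (m + 2) → MvPolynomial (Fin (m + 2)) K) l 1 j) (Φ + Ψ) = X l ^ μ * G ∧
        ∀ P : Ideal (MvPolynomial (Fin (m + 2)) K), P.IsPrime → (X l : MvPolynomial (Fin (m + 2)) K) ∈ P → G ∈ P → ∃ j, pderiv j G ∉ P)
    (hsing : ∀ c ∈ S, ∀ P : Ideal (MvPolynomial (Fin (m + 2)) K), P.IsPrime → ProjectiveSpace.dehomogenize K c F ∈ P →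
      (∀ j, pderiv j (ProjectiveSpace.dehomogenize K c F) ∈ P) → ∀ j, (X j : MvPolynomial (Fin (m + 2)) K) ∈ P)
    (hoffS : letI := MvPolynomial.gradedAlgebra (σ := Fin (m + 2 + 1)) (R := K)
      ∀ c, c ∉ S → IsRegularRing (ChartRing F c hF)) :
    letI := MvPolynomial.gradedAlgebra (σ := Fin (m + 2 + 1)) (R := K)
    ∃ 𝔞 : (hypersurface F).left.IdealSheafData, 𝔞 ≠ ⊥ ∧
      ∀ (Z : Scheme.{0}) (π : Z ⟶ (hypersurface F).left), IsBlowup π 𝔞 → Scheme.IsRegular Z := by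
  letI := MvPolynomial.gradedAlgebra (σ := Fin (m + 2 + 1)) (R := K)
  letI := MvPolynomial.gradedAlgebra (σ := Fin (0 + 1)) (R := K)
  have he : ∀ c : Fin (m + 2 + 1), Function.Injective (fun _ : Fin 1 => c) := fun c => Function.injective_of_subsingleton _
  have hexk : ∀ c : Fin (m + 2 + 1), ∃ (g : homogeneousSubmodule (Fin (m + 2 + 1)) K →+*ᵍ homogeneousSubmodule (Fin (0 + 1)) K)
      (_ : HomogeneousIdeal.irrelevant (homogeneousSubmodule (Fin (0 + 1)) K) ≤
        (HomogeneousIdeal.irrelevant (homogeneousSubmodule (Fin (m + 2 + 1)) K)).map g),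
      (∀ a : K, g (C a) = C a) ∧ (∀ j : Fin 1, g (X ((fun _ : Fin 1 => c) j)) = X j) ∧
        (∀ i : Fin (m + 2 + 1), i ∉ Set.range (fun _ : Fin 1 => c) → g (X i) = 0) := fun c =>
    Summit.ResolutionOfSingularities.ResolutionOfSingularities.Cruxes.EquisingularLiftNat.LinearCentre.exists_kill (R := K) (fun _ : Fin 1 => c) (he c)
  choose fk hfk' hfkC hfke hfk0 using hexk
  have hfke' : ∀ c (j : Fin 1), fk c (X c) = X j := fun c j => hfke c j
  have hfk0' : ∀ c (i : Fin (m + 2 + 1)), i ≠ c → fk c (X i) = 0 := fun c i hi => hfk0 c i (fun ⟨_, hj⟩ => hi hj.symm)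
  exact ⟨_, MultiOrd.comap_prod_ne_bot K F hF hFp S fk hfk' hfkC hfke' hfk0',
    fun Z ρ hρ => OneStep.isRegular_of_isBlowup_comap_prod K F hF hFp S hS hone hsing hoffS fk hfk' hfkC hfke' hfk0' Z ρ hρ⟩

/-- ★ **Hypersurfaces whose singular points are FIRST-ORDER POINTS at coordinate vertices have regular blow-up models — every field, every characteristic,
every dimension.**  As `blowupModel_oneStepPoints`, the vertex charts now split as `F(x_c := 1) = Φ + (Ψ₁ + Ψ')` (`Φ ≠ 0` of degree `μ ≥ 1`, `Ψ₁` of degree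
`μ + 1`, `Ψ' ∈ (y)^{μ+2}`) with the intrinsic first-order criterion (FO) «every prime containing `Φ`, all `∂Φ/∂y_i` and `Ψ₁` contains all `y_i`» in place of
the explicit strict transforms (✓ `FirstOrderPoint.exists_strictTransform` supplies them).  Contains the `A₂` points and the characteristic-2 nodes
(✓ `FirstOrderPoint.firstOrder_A₂` / `firstOrder_node`). [cite: Hartshorne1977, II Ex. 7.12] [cite: StacksProject, Tag 080A] -/
theorem blowupModel_firstOrderPoints (K : Type) [Field K] {m : ℕ} (F : MvPolynomial (Fin (m + 2 + 1)) K) {d : ℕ} (hF : F.IsHomogeneous d)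
    (hFp : Prime F) (S : List (Fin (m + 2 + 1))) (hS : S.Nodup)
    (hfo : ∀ c ∈ S, ∃ (μ : ℕ) (Φ Ψ₁ Ψ' : MvPolynomial (Fin (m + 2)) K), 1 ≤ μ ∧ Φ.IsHomogeneous μ ∧ Φ ≠ 0 ∧ Ψ₁.IsHomogeneous (μ + 1) ∧
      Ψ' ∈ Ideal.span (Set.range (X : Fin (m + 2) → MvPolynomial (Fin (m + 2)) K)) ^ (μ + 2) ∧
      ProjectiveSpace.dehomogenize K c F = Φ + (Ψ₁ + Ψ') ∧
      ∀ P : Ideal (MvPolynomial (Fin (m + 2)) K), P.IsPrime → Φ ∈ P → (∀ i, pderiv i Φ ∈ P) → Ψ₁ ∈ P →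
        ∀ i, (X i : MvPolynomial (Fin (m + 2)) K) ∈ P)
    (hsing : ∀ c ∈ S, ∀ P : Ideal (MvPolynomial (Fin (m + 2)) K), P.IsPrime → ProjectiveSpace.dehomogenize K c F ∈ P →
      (∀ j, pderiv j (ProjectiveSpace.dehomogenize K c F) ∈ P) → ∀ j, (X j : MvPolynomial (Fin (m + 2)) K) ∈ P)
    (hoffS : letI := MvPolynomial.gradedAlgebra (σ := Fin (m + 2 + 1)) (R := K)
      ∀ c, c ∉ S → IsRegularRing (ChartRing F c hF)) :
    letI := MvPolynomial.gradedAlgebra (σ := Fin (m + 2 + 1)) (R := K)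
    ∃ 𝔞 : (hypersurface F).left.IdealSheafData, 𝔞 ≠ ⊥ ∧
      ∀ (Z : Scheme.{0}) (π : Z ⟶ (hypersurface F).left), IsBlowup π 𝔞 → Scheme.IsRegular Z := by
  refine blowupModel_oneStepPoints K F hF hFp S hS (fun c hc => ?_) hsing hoffS
  obtain ⟨μ, Φ, Ψ₁, Ψ', hμ, hΦ, hΦ0, hΨ₁, hΨ', hdeh, hcrit⟩ := hfo c hc
  exact ⟨μ, Φ, Ψ₁ + Ψ', hμ, hΦ, hΦ0, FirstOrderPoint.add_mem_pow_succ K hΨ₁ hΨ', hdeh,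
    fun l => FirstOrderPoint.exists_strictTransform K Φ Ψ₁ Ψ' hΦ hΨ₁ hΨ' hcrit l⟩

/-- ★ **The same in the crux's binder shape** — every field: for the crux's `ι : H ↪ ℙ^{m+2}_K` (closed immersion, `H` integral) with `range ι = V₊(F)`,
`F` a prime form whose singular points are first-order points at coordinate vertices (hypotheses of `blowupModel_firstOrderPoints`), `H` has a non-zero
ideal sheaf all of whose blow-ups are regular (✓ `blowupModel_of_range_eq`). [cite: Hartshorne1977, II Ex. 7.12] -/
theorem blowupModel_of_range_eq_firstOrderPoints {K : Type} [Field K] {m : ℕ} {H : Scheme.{0}}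
    (ι : H ⟶ (projectiveSpace (m + 2) K).left) [IsClosedImmersion ι] [IsIntegral H]
    (F : MvPolynomial (Fin (m + 2 + 1)) K) {d : ℕ} (hF : F.IsHomogeneous d) (hFp : Prime F) (S : List (Fin (m + 2 + 1))) (hS : S.Nodup)
    (hfo : ∀ c ∈ S, ∃ (μ : ℕ) (Φ Ψ₁ Ψ' : MvPolynomial (Fin (m + 2)) K), 1 ≤ μ ∧ Φ.IsHomogeneous μ ∧ Φ ≠ 0 ∧ Ψ₁.IsHomogeneous (μ + 1) ∧
      Ψ' ∈ Ideal.span (Set.range (X : Fin (m + 2) → MvPolynomial (Fin (m + 2)) K)) ^ (μ + 2) ∧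
      ProjectiveSpace.dehomogenize K c F = Φ + (Ψ₁ + Ψ') ∧
      ∀ P : Ideal (MvPolynomial (Fin (m + 2)) K), P.IsPrime → Φ ∈ P → (∀ i, pderiv i Φ ∈ P) → Ψ₁ ∈ P →
        ∀ i, (X i : MvPolynomial (Fin (m + 2)) K) ∈ P)
    (hsing : ∀ c ∈ S, ∀ P : Ideal (MvPolynomial (Fin (m + 2)) K), P.IsPrime → ProjectiveSpace.dehomogenize K c F ∈ P →
      (∀ j, pderiv j (ProjectiveSpace.dehomogenize K c F) ∈ P) → ∀ j, (X j : MvPolynomial (Fin (m + 2)) K) ∈ P)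
    (hoffS : letI := MvPolynomial.gradedAlgebra (σ := Fin (m + 2 + 1)) (R := K)
      ∀ c, c ∉ S → IsRegularRing (ChartRing F c hF))
    (hrange : letI := MvPolynomial.gradedAlgebra (σ := Fin (m + 2 + 1)) (R := K)
      Set.range ι = {x : Proj (homogeneousSubmodule (Fin (m + 2 + 1)) K) | F ∈ x.asHomogeneousIdeal}) :
    ∃ 𝔞 : H.IdealSheafData, 𝔞 ≠ ⊥ ∧ ∀ (Z : Scheme.{0}) (π : Z ⟶ H), IsBlowup π 𝔞 → Scheme.IsRegular Z :=
  letI := MvPolynomial.gradedAlgebra (σ := Fin (m + 2 + 1)) (R := K)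
  blowupModel_of_range_eq ι F hF hFp hrange (blowupModel_firstOrderPoints K F hF hFp S hS hfo hsing hoffS)

/-- ★ **The same over an ALGEBRAICALLY CLOSED field with the hypotheses on closed points**: (jac) every `a ≠ 0` with `F(a) = 0`, `∇F(a) = 0` is a multiple of
a marked vertex `e_c`, `c ∈ S`; (fo) at each `c ∈ S`, `F(x_c := 1) = Φ + (Ψ₁ + Ψ')` as above with `Φ(b) = ∇Φ(b) = Ψ₁(b) = 0` only for `b = 0`
(✓ `MultiOrd.hsing_of_jacobian`, ✓ `MultiOrd.isRegularRing_chartRing_of_jacobian`, ✓ `FirstOrderPoint.firstOrder_of_forall_aeval`).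
[cite: Hartshorne1977, I Thm. 5.1] [cite: StacksProject, Tag 07PF] -/
theorem blowupModel_of_range_eq_firstOrderPoints_of_jacobian {K : Type} [Field K] [IsAlgClosed K] {m : ℕ} {H : Scheme.{0}}
    (ι : H ⟶ (projectiveSpace (m + 2) K).left) [IsClosedImmersion ι] [IsIntegral H]
    (F : MvPolynomial (Fin (m + 2 + 1)) K) {d : ℕ} (hF : F.IsHomogeneous d) (hFp : Prime F) (S : List (Fin (m + 2 + 1))) (hS : S.Nodup)
    (hjac : ∀ a : Fin (m + 2 + 1) → K, a ≠ 0 → eval a F = 0 → (∀ i, eval a (pderiv i F) = 0) → ∃ c ∈ S, ∀ i, i ≠ c → a i = 0)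
    (hfo : ∀ c ∈ S, ∃ (μ : ℕ) (Φ Ψ₁ Ψ' : MvPolynomial (Fin (m + 2)) K), 1 ≤ μ ∧ Φ.IsHomogeneous μ ∧ Φ ≠ 0 ∧ Ψ₁.IsHomogeneous (μ + 1) ∧
      Ψ' ∈ Ideal.span (Set.range (X : Fin (m + 2) → MvPolynomial (Fin (m + 2)) K)) ^ (μ + 2) ∧
      ProjectiveSpace.dehomogenize K c F = Φ + (Ψ₁ + Ψ') ∧
      ∀ b : Fin (m + 2) → K, aeval b Φ = 0 → (∀ i, aeval b (pderiv i Φ) = 0) → aeval b Ψ₁ = 0 → b = 0)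
    (hrange : letI := MvPolynomial.gradedAlgebra (σ := Fin (m + 2 + 1)) (R := K)
      Set.range ι = {x : Proj (homogeneousSubmodule (Fin (m + 2 + 1)) K) | F ∈ x.asHomogeneousIdeal}) :
    ∃ 𝔞 : H.IdealSheafData, 𝔞 ≠ ⊥ ∧ ∀ (Z : Scheme.{0}) (π : Z ⟶ H), IsBlowup π 𝔞 → Scheme.IsRegular Z := by
  letI := MvPolynomial.gradedAlgebra (σ := Fin (m + 2 + 1)) (R := K)
  refine blowupModel_of_range_eq_firstOrderPoints ι F hF hFp S hS (fun c hc => ?_)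
    (fun c _ P hP hf hPj j => MultiOrd.hsing_of_jacobian F hF S hjac c P hP hf hPj j)
    (fun c hc => MultiOrd.isRegularRing_chartRing_of_jacobian F hF S hjac hFp c hc) hrange
  obtain ⟨μ, Φ, Ψ₁, Ψ', hμ, hΦ, hΦ0, hΨ₁, hΨ', hdeh, h⟩ := hfo c hc
  exact ⟨μ, Φ, Ψ₁, Ψ', hμ, hΦ, hΦ0, hΨ₁, hΨ', hdeh,
    fun P hP hΦP hdP hΨP => FirstOrderPoint.firstOrder_of_forall_aeval K Φ Ψ₁ h P hP hΦP hdP hΨP⟩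

end Summit.ResolutionOfSingularities.ResolutionOfSingularities.Cruxes.EquisingularLift.StrataSplit

end
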